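import Mathlib
import Summits.Ventures.HodgeRepro.Tier4.Common.TargetData
import Summits.Ventures.HodgeRepro.Tier4.Common.SettingOfData
import Summits.Ventures.HodgeRepro.Tier4.Line1.DefinedContentOfData
import Summits.Ventures.HodgeRepro.Tier4.Line1.SpectralOfRTF
import Summits.Ventures.HodgeRepro.Tier4.Line1.IdentificationSplit
import Summits.Ventures.HodgeRepro.Tier4.Line1.LiftOfPeriods

/-!
# Tier4/Line1/ResidualDirect — LINE L1, (I5-R): THE DIRECT RESIDUAL OF THE LINE AS A TREE OBJECT

Blind re-derivation cell `pub-hodge-repro`, Tier 4 «prove the step» (README §9–§10), seat t4-L1-p4 (gen 3; the cut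
(9) of t4-plan-1 g2, bus S13521).  Imports ONLY Mathlib, typer-1's `Common/TargetData` (`TargetData`, `conclusion`,
`P_T4_of_forall`), typer-2's `Common/SettingOfData` (`Setting.ofAdelicData`, the sorry-free RTF setting on the
defined adelic objects with DISPLAYED cocompactness data), t4-L1-p3's `Line1/DefinedContentOfData`
(`isCharacter_ofAdelicData`, `isCharacter'_ofAdelicData`, `exists_defined_content_ofData`), t4-L1-p1's
`Line1/SpectralOfRTF` (`SpectralIdentification`, `IsolationNonvanishing`, `conclusion_of_rtf_identification`) and this
seat's `Line1/IdentificationSplit` (`HodgePairingEqJ`, `FiniteSpectrum`, `spectralIdentification_of_split`) and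
`Line1/LiftOfPeriods` (`PeriodData`, `hlift_of_printed`).

WHAT THIS IS.  The skeleton of LINE L1 (t4-plan-1, Skeleton v0.35, bus S13508 / S13513) states the line's residual of
record as «`Nonempty (Inputs' d)` for every datum `d`», where `Inputs'` is the free-input structure of t4-L1-p1's
`conclusion_of_rtf_identification`, one field each.  Skeleton files never go through the gate, so that residual had no
p-id.  `ResidualDirect d` below is the SAME structure as a tree object — its fields are those of `Inputs'` VERBATIM,
with the one change the tree constructor demands: the setting is typer-2's `Setting.ofAdelicData pl R μ DG fdG compG
hT hT'`, so the skeleton's `hdef : IsDefinite pl`, `hgen : IsGenuineRow pl` (which choose a fundamental domain through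
the declared wall `quotient_compact`) are replaced by the DISPLAYED cocompactness data `DG`, `fdG`, `compG` (supplied
by name for a genuine definite plane by `quotient_compact_genuine`; the skeleton's `Inputs'.toResidualDirect` is then
`rfl`-level through `Setting.ofAdelic_eq_ofAdelicData`).  Nothing is proved about the residual's free fields:

* `structure ResidualDirect (d)` — the level `Γ'` with the printed `hcc`; the plane `pl`; the adelic data `R` (N2 =
  `chi_centre` inside — forced by the defined block, CentralVanishingAdelic `eq_on_centre_of_isolated_ofAdelicData`);
  `μ`, `DG`, `fdG`, `compG`, `hT`, `hT'`; the continuity / unitarity of `R`'s characters; the DEFINED block `τ φ n hB f₁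
  f₂ h₁ h₂ hconv o₀ hiso hne` (realisable by name: `defined_residual_realisable`); the lift clause `Lift` with `hlift`
  for the GIVEN `f₁`; the DATA `tf`, `spec` of the Hecke choices; (S1′) `hS1`; (S3′) `hS3`;
* **`conclusion_of_residualDirect (I : ResidualDirect d) : d.conclusion`** — p1's `conclusion_of_rtf_identification`
  by name;
* **`P_T4_of_residualDirect (h : ∀ F E … d, Nonempty (ResidualDirect d)) : P_T4`** — `P_T4_of_forall`;
* `defined_residual_realisable` — p3's `exists_defined_content_ofData` under the residual's name;
* `ResidualDirect.ofSplit` — the residual from the SPLIT form of (S1′) (`HodgePairingEqJ` ∧ `FiniteSpectrum` +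
  per-choice test hypotheses), and `ResidualDirect.ofPrintedLift` — the residual with `hlift` supplied by the printed
  shape of LiftOfPeriods (`hlift_of_printed`) on a face: the tree carries all three forms.

JUNK TEST (recorded, not a theorem of this file): `ResidualDirect d` cannot be cheaply inhabited for every `d` —
`P_T4_of_residualDirect` would then prove `P_T4`, which is refuted on paper on the twisted member with the kernel
bridge `Negative.not_P_T4_of_twistedInstance : TwistedInstance → ¬ P_T4` (Tier4/Negative/TwistObstruction); per field,
the docstrings say what is data and what is displayed.  Nothing here says anything about the status of the Hodge
conjecture for CM abelian varieties, which is NOT proved (HC_CM is NOT proved by anyone in this repository).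
-/

set_option autoImplicit false

noncomputable section

namespace Summit.Ventures.HodgeRepro.Tier4.Line1

open NumberField Common PeriodCloser MeasureTheory

section Residual

variable {F E : Type} [Field F] [NumberField F] [IsGalois ℚ F] [IsCMField F]
  [Field E] [NumberField E] [IsGalois ℚ E] [IsCMField E]

/-- **THE RESIDUAL OF LINE L1, DIRECT FORM, AS A TREE OBJECT** — the free inputs of t4-L1-p1's
`conclusion_of_rtf_identification`, one field each (the skeleton's `Inputs'`, Skeleton v0.35 L1492–L1583, with the
setting on typer-2's tree constructor `Setting.ofAdelicData`): the level with the printed `hcc`; the plane; the RTF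
data `R` (N2 inside) with `μ`, the displayed cocompactness data `DG fdG compG`, the torus domains and the continuity /
unitarity of its characters; the DEFINED block (realisable by name, `defined_residual_realisable`); the lift clause
`Lift` with `hlift` for the GIVEN `f₁`; the test-pair map `tf` and the finite spectra `spec` of the Hecke choices (DATA
of the residual, constructed nowhere); (S1′) the identification and (S3′) isolation with a non-zero block.
`Nonempty (ResidualDirect d)` for every `d` is what the line still owes (`conclusion_of_residualDirect`,
`P_T4_of_residualDirect`). -/
structure ResidualDirect (d : TargetData F E) where
  /-- the level `Γ′ ≤ Γ` -/
  Γ' : Set (Matrix (Fin 3) (Fin 3) E)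
  /-- … a congruence subgroup contained in `Γ` -/
  hΓ' : d.IsLevel Γ'
  /-- … acting cocompactly on the ball (the printed Borel–Harish-Chandra input at the base level; every deep level
  `Γ ∩ Γ(N)` by LevelDescent) -/
  hcc : d.IsCocompact Γ'
  /-- the totally real field `k = E′⁺` -/
  k : Type
  [fk : Field k]
  [nk : NumberField k]
  /-- the hermitian plane of the seesaw in a `k`-basis -/
  pl : PlaneData k
  [ms : MeasurableSpace (GA pl)]
  [bs : BorelSpace (GA pl)]
  /-- the characters, torus measures and fundamental domains — N2 = `chi_centre` inside (forced by the defined block: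
  `eq_on_centre_of_isolated_ofAdelicData`) -/
  R : RTFData pl
  /-- a Haar measure on `U(W)(𝔸_k)` -/
  μ : Measure (GA pl)
  [haar : μ.IsHaarMeasure]
  [haarT : R.μT.IsHaarMeasure]
  [haarT' : R.μT'.IsHaarMeasure]
  /-- DISPLAYED cocompactness data: a fundamental domain of `U(W)(k)` in `U(W)(𝔸_k)` … -/
  DG : Set (GA pl)
  /-- … which is a fundamental domain for `μ` … -/
  fdG : IsFundamentalDomain (rationalPoints pl) DG μ
  /-- … and relatively compact (supplied by name for a genuine definite plane: `quotient_compact_genuine`) -/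
  compG : IsCompact (closure DG)
  /-- the torus domain is relatively compact -/
  hT : IsCompact (closure R.DT)
  /-- the second torus domain is relatively compact -/
  hT' : IsCompact (closure R.DT')
  /-- `χ` is continuous -/
  hc : Continuous R.chi
  /-- `χ` is unitary -/
  hu : ∀ a, ‖R.chi a‖ = 1
  /-- `χ′` is continuous -/
  hc' : Continuous R.chi'
  /-- `χ′` is unitary -/
  hu' : ∀ a, ‖R.chi' a‖ = 1
  /-- the invariant subspaces (the discrete spectrum) -/
  τ : ℕ → Set (GA pl → ℂ)
  /-- the adapted orthonormal family -/
  φ : ℕ → GA pl → ℂ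
  /-- `φ j ∈ τ (n j)` -/
  n : ℕ → ℕ
  /-- (J1) the family is an adapted orthonormal basis of the setting -/
  hB : (Setting.ofAdelicData pl R μ DG fdG compG hT hT').IsAdaptedONB τ φ n
  /-- the first factor of the test function (F2′: its `S`-components the admissible projector `e_S`) -/
  f₁ : GA pl → ℂ
  /-- the second factor of the test function -/
  f₂ : GA pl → ℂ
  /-- `f₁` is a test function -/
  h₁ : RTF.IsTest f₁
  /-- `f₂` is a test function -/
  h₂ : RTF.IsTest f₂
  /-- `f₁ ⋆ f₂` is a test function -/
  hconv : RTF.IsTest ((Setting.ofAdelicData pl R μ DG fdG compG hT hT').conv f₁ f₂)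
  /-- the isolated rational double coset -/
  o₀ : (Setting.ofAdelicData pl R μ DG fdG compG hT hT').Orbit
  /-- (J2) exactly one rational double coset meets the support of `f₁ ⋆ f₂` on `DT × DT′` -/
  hiso : (Setting.ofAdelicData pl R μ DG fdG compG hT hT').geoSupport
    ((Setting.ofAdelicData pl R μ DG fdG compG hT hT').conv f₁ f₂) = {o₀}
  /-- (J2) its orbital term is non-zero -/
  hne : (Setting.ofAdelicData pl R μ DG fdG compG hT hT').orbital R.chi R.chi' o₀
    ((Setting.ofAdelicData pl R μ DG fdG compG hT hT').conv f₁ f₂) ≠ 0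
  /-- FREE: the lift clause on the `m`-th invariant subspace -/
  Lift : ℕ → Prop
  /-- FREE F1 + F2 (+ F2′): an invariant subspace hit by `f̄₁` (admissible type) with both toric functionals has a
  non-zero `(2,0)`-theta lift — for the GIVEN `f₁` (printed shape by name: LiftOfPeriods `hlift_of_printed`) -/
  hlift : ∀ m, (Setting.ofAdelicData pl R μ DG fdG compG hT hT').PeriodNonzeroT R.chi (τ m) →
    (Setting.ofAdelicData pl R μ DG fdG compG hT hT').PeriodNonzeroT' R.chi' (τ m) →
    (Setting.ofAdelicData pl R μ DG fdG compG hT hT').Hit (RTF.cj f₁) (τ m) → Lift m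
  /-- DATA of the residual: the test pair of each Hecke choice of translates (constructed nowhere) -/
  tf : (d.concreteWitness hΓ' (isDomain_dom d hΓ').subset_ball (isDomain_dom d hΓ').measurableSet
    (d.residual_of_cocompact hΓ' hcc)).Translates → (GA pl → ℂ) × (GA pl → ℂ)
  /-- DATA of the residual: the finite spectrum of each Hecke choice (constructed nowhere) -/
  spec : (d.concreteWitness hΓ' (isDomain_dom d hΓ').subset_ball (isDomain_dom d hΓ').measurableSet
    (d.residual_of_cocompact hΓ' hcc)).Translates → Finset ℕ
  /-- FREE (S1′) — THE IDENTIFICATION: the concrete Hodge pairing of each choice `γ` is the finite sum over `spec γ` of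
  the RTF's spectral blocks at `tf γ` (split form: IdentificationSplit (S1a) `HodgePairingEqJ` ∧ (S1b)
  `FiniteSpectrum`) -/
  hS1 : SpectralIdentification (Setting.ofAdelicData pl R μ DG fdG compG hT hT') R.chi R.chi' φ n tf spec
  /-- FREE (S3′) — ISOLATION WITH A NON-ZERO BLOCK: an index `m` with both toric functionals and the lift clause is the
  whole spectrum of some choice `γ′` whose `m`-block is non-zero (Hecke isolation + Rallis) -/
  hS3 : IsolationNonvanishing (Setting.ofAdelicData pl R μ DG fdG compG hT hT') R.chi R.chi' τ Lift φ n tf spec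

attribute [instance] ResidualDirect.fk ResidualDirect.nk ResidualDirect.ms ResidualDirect.bs
  ResidualDirect.haar ResidualDirect.haarT ResidualDirect.haarT'

/-- **The conclusion of `P_T4` for `d` from the direct residual** (PROVED: t4-L1-p1's
`conclusion_of_rtf_identification` BY NAME, the characters through p3's `isCharacter_ofAdelicData` /
`isCharacter'_ofAdelicData`). -/
theorem conclusion_of_residualDirect {d : TargetData F E} (I : ResidualDirect d) : d.conclusion :=
  conclusion_of_rtf_identification d I.hΓ' I.hcc
    (Setting.ofAdelicData I.pl I.R I.μ I.DG I.fdG I.compG I.hT I.hT')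
    (isCharacter_ofAdelicData I.pl I.R I.μ I.DG I.fdG I.compG I.hT I.hT' I.hc I.hu)
    (isCharacter'_ofAdelicData I.pl I.R I.μ I.DG I.fdG I.compG I.hT I.hT' I.hc' I.hu')
    I.hB I.h₁ I.h₂ I.hconv I.hiso I.hne I.Lift I.hlift I.tf I.spec I.hS1 I.hS3

end Residual

/-- **`P_T4` from the direct residual at every datum** (PROVED): the line's target under the ONE hypothesis
«`ResidualDirect d` is inhabited for every datum `d`» — the residual of record of LINE L1 as a tree statement. -/
theorem P_T4_of_residualDirect
    (h : ∀ (F E : Type) [Field F] [NumberField F] [IsGalois ℚ F] [IsCMField F] [Field E] [NumberField E]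
      [IsGalois ℚ E] [IsCMField E] (d : TargetData F E), Nonempty (ResidualDirect d)) : P_T4 :=
  P_T4_of_forall fun F E _ _ _ _ _ _ _ _ d => conclusion_of_residualDirect (F := F) (E := E) (h F E d).some

section Realisable

variable {k : Type} [Field k] [NumberField k] (pl : PlaneData k)

/-- **The DEFINED block of the residual is realisable by name** for every genuine definite plane, adelic data with
continuous unitary characters (N2 inside) and displayed cocompactness data — t4-L1-p3's
`exists_defined_content_ofData` under the residual's name: the fields `τ φ n hB f₁ f₂ h₁ h₂ hconv o₀ hiso hne`. -/
theorem defined_residual_realisable (hW : IsDefinite pl) (hg : IsGenuineRow pl) [MeasurableSpace (GA pl)]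
    [BorelSpace (GA pl)] (R : RTFData pl) (μ : Measure (GA pl)) [μ.IsHaarMeasure] [R.μT.IsHaarMeasure]
    [R.μT'.IsHaarMeasure] (DG : Set (GA pl)) (fdG : IsFundamentalDomain (rationalPoints pl) DG μ)
    (compG : IsCompact (closure DG)) (hT : IsCompact (closure R.DT)) (hT' : IsCompact (closure R.DT'))
    (hc : Continuous R.chi) (hu : ∀ a, ‖R.chi a‖ = 1) (hc' : Continuous R.chi') (hu' : ∀ a, ‖R.chi' a‖ = 1) :
    ∃ (τ : ℕ → Set (GA pl → ℂ)) (φ : ℕ → GA pl → ℂ) (n : ℕ → ℕ) (f₁ f₂ : GA pl → ℂ)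
      (o₀ : (Setting.ofAdelicData pl R μ DG fdG compG hT hT').Orbit),
      (Setting.ofAdelicData pl R μ DG fdG compG hT hT').IsAdaptedONB τ φ n ∧
      RTF.IsTest f₁ ∧ RTF.IsTest f₂ ∧
      RTF.IsTest ((Setting.ofAdelicData pl R μ DG fdG compG hT hT').conv f₁ f₂) ∧
      (Setting.ofAdelicData pl R μ DG fdG compG hT hT').geoSupport
        ((Setting.ofAdelicData pl R μ DG fdG compG hT hT').conv f₁ f₂) = {o₀} ∧
      (Setting.ofAdelicData pl R μ DG fdG compG hT hT').orbital R.chi R.chi' o₀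
        ((Setting.ofAdelicData pl R μ DG fdG compG hT hT').conv f₁ f₂) ≠ 0 :=
  exists_defined_content_ofData pl R μ DG fdG compG hT hT' hW hg hc hu hc' hu'

end Realisable

section Constructors

variable {F E : Type} [Field F] [NumberField F] [IsGalois ℚ F] [IsCMField F]
  [Field E] [NumberField E] [IsGalois ℚ E] [IsCMField E]
  (d : TargetData F E) (Γ' : Set (Matrix (Fin 3) (Fin 3) E)) (hΓ' : d.IsLevel Γ') (hcc : d.IsCocompact Γ')
  (k : Type) [Field k] [NumberField k] (pl : PlaneData k) [MeasurableSpace (GA pl)] [BorelSpace (GA pl)]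
  (R : RTFData pl) (μ : Measure (GA pl)) [μ.IsHaarMeasure] [R.μT.IsHaarMeasure] [R.μT'.IsHaarMeasure]
  (DG : Set (GA pl)) (fdG : IsFundamentalDomain (rationalPoints pl) DG μ) (compG : IsCompact (closure DG))
  (hT : IsCompact (closure R.DT)) (hT' : IsCompact (closure R.DT'))
  (hc : Continuous R.chi) (hu : ∀ a, ‖R.chi a‖ = 1) (hc' : Continuous R.chi') (hu' : ∀ a, ‖R.chi' a‖ = 1)
  (τ : ℕ → Set (GA pl → ℂ)) (φ : ℕ → GA pl → ℂ) (n : ℕ → ℕ)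
  (hB : (Setting.ofAdelicData pl R μ DG fdG compG hT hT').IsAdaptedONB τ φ n)
  (f₁ f₂ : GA pl → ℂ) (h₁ : RTF.IsTest f₁) (h₂ : RTF.IsTest f₂)
  (hconv : RTF.IsTest ((Setting.ofAdelicData pl R μ DG fdG compG hT hT').conv f₁ f₂))
  (o₀ : (Setting.ofAdelicData pl R μ DG fdG compG hT hT').Orbit)
  (hiso : (Setting.ofAdelicData pl R μ DG fdG compG hT hT').geoSupport
    ((Setting.ofAdelicData pl R μ DG fdG compG hT hT').conv f₁ f₂) = {o₀})
  (hne : (Setting.ofAdelicData pl R μ DG fdG compG hT hT').orbital R.chi R.chi' o₀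
    ((Setting.ofAdelicData pl R μ DG fdG compG hT hT').conv f₁ f₂) ≠ 0)
  (Lift : ℕ → Prop)
  (tf : (d.concreteWitness hΓ' (isDomain_dom d hΓ').subset_ball (isDomain_dom d hΓ').measurableSet
    (d.residual_of_cocompact hΓ' hcc)).Translates → (GA pl → ℂ) × (GA pl → ℂ))
  (spec : (d.concreteWitness hΓ' (isDomain_dom d hΓ').subset_ball (isDomain_dom d hΓ').measurableSet
    (d.residual_of_cocompact hΓ' hcc)).Translates → Finset ℕ)
  (hS3 : IsolationNonvanishing (Setting.ofAdelicData pl R μ DG fdG compG hT hT') R.chi R.chi' τ Lift φ n tf spec)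

/-- **The residual from the SPLIT form of (S1′)**: the same fields with (S1′) replaced by (S1a) `HodgePairingEqJ`,
(S1b) `FiniteSpectrum` and the per-choice test hypotheses (IdentificationSplit `spectralIdentification_of_split`). -/
def ResidualDirect.ofSplit
    (hlift : ∀ m, (Setting.ofAdelicData pl R μ DG fdG compG hT hT').PeriodNonzeroT R.chi (τ m) →
      (Setting.ofAdelicData pl R μ DG fdG compG hT hT').PeriodNonzeroT' R.chi' (τ m) →
      (Setting.ofAdelicData pl R μ DG fdG compG hT hT').Hit (RTF.cj f₁) (τ m) → Lift m)
    (htf₁ : ∀ γ, RTF.IsTest (tf γ).1) (htf₂ : ∀ γ, RTF.IsTest (tf γ).2)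
    (hJ : HodgePairingEqJ (Setting.ofAdelicData pl R μ DG fdG compG hT hT') R.chi R.chi' tf)
    (hfin : FiniteSpectrum (Setting.ofAdelicData pl R μ DG fdG compG hT hT') R.chi R.chi' φ n tf spec) :
    ResidualDirect d where
  Γ' := Γ'
  hΓ' := hΓ'
  hcc := hcc
  k := k
  pl := pl
  R := R
  μ := μ
  DG := DG
  fdG := fdG
  compG := compG
  hT := hT
  hT' := hT'
  hc := hc
  hu := hu
  hc' := hc'
  hu' := hu'
  τ := τ
  φ := φ
  n := n
  hB := hB
  f₁ := f₁
  f₂ := f₂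
  h₁ := h₁
  h₂ := h₂
  hconv := hconv
  o₀ := o₀
  hiso := hiso
  hne := hne
  Lift := Lift
  hlift := hlift
  tf := tf
  spec := spec
  hS1 := spectralIdentification_of_split (Setting.ofAdelicData pl R μ DG fdG compG hT hT') R.chi R.chi' φ n tf spec
    (isCharacter_ofAdelicData pl R μ DG fdG compG hT hT' hc hu)
    (isCharacter'_ofAdelicData pl R μ DG fdG compG hT hT' hc' hu') hB htf₁ htf₂ hJ hfin
  hS3 := hS3

/-- **The residual with `hlift` in its PRINTED shape**: the same fields with the lift clause supplied by LiftOfPeriods'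
`hlift_of_printed` on a face `(sideWithRTFSpectrum E₀ S R.chi R.chi' τ tl Lift).toC7Face` — the lift interfaces
`J T H`, the five printed statements and the three `τ`-level clauses on the period-carrying indices. -/
def ResidualDirect.ofPrintedLift
    {Θ : ThetaLifts (d.concreteWitness hΓ' (isDomain_dom d hΓ').subset_ball (isDomain_dom d hΓ').measurableSet
      (d.residual_of_cocompact hΓ' hcc))}
    (E₀ : EndoscopicSide E (d.concreteWitness hΓ' (isDomain_dom d hΓ').subset_ball
      (isDomain_dom d hΓ').measurableSet (d.residual_of_cocompact hΓ' hcc)) Θ)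
    (tl : Θ.U1Char → ℕ)
    (J : LiftInterface (sideWithRTFSpectrum E₀ (Setting.ofAdelicData pl R μ DG fdG compG hT hT') R.chi R.chi' τ tl
      Lift).toC7Face)
    (T : Lit.LocalThetaInterface (sideWithRTFSpectrum E₀ (Setting.ofAdelicData pl R μ DG fdG compG hT hT') R.chi
      R.chi' τ tl Lift).toC7Face J)
    (H : Lit.HeckeLInterface (sideWithRTFSpectrum E₀ (Setting.ofAdelicData pl R μ DG fdG compG hT hT') R.chi R.chi'
      τ tl Lift).toC7Face)
    (hG : GQT14_Thm3 _ J) (hGI : Lit.GanIchino2016_Thm4_4_i _ J T) (hMi : Lit.Minguez2008_Thm1_split _ J T)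
    (h44 : Lit.Iwasawa1964_Prop4_4 _ H) (hfac : Lit.EdgeFactorization _ J H)
    (hdodge : ∀ m, (Setting.ofAdelicData pl R μ DG fdG compG hT hT').PeriodData R.chi R.chi' τ f₁ m →
      ∀ v, ¬ T.IsArch v →
        ¬ (sideWithRTFSpectrum E₀ (Setting.ofAdelicData pl R μ DG fdG compG hT hT') R.chi R.chi' τ tl
          Lift).toC7Face.IsSplit v → ¬ T.ParamContainsChiV v m)
    (harch : ∀ m, (Setting.ofAdelicData pl R μ DG fdG compG hT hT').PeriodData R.chi R.chi' τ f₁ m →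
      ∀ v, T.IsArch v → J.localLiftNonzero v m)
    (hhol : ∀ m, (Setting.ofAdelicData pl R μ DG fdG compG hT hT').PeriodData R.chi R.chi' τ f₁ m →
      J.holomorphicType m)
    (hS1 : SpectralIdentification (Setting.ofAdelicData pl R μ DG fdG compG hT hT') R.chi R.chi' φ n tf spec) :
    ResidualDirect d where
  Γ' := Γ'
  hΓ' := hΓ'
  hcc := hcc
  k := k
  pl := pl
  R := R
  μ := μ
  DG := DG
  fdG := fdG
  compG := compG
  hT := hT
  hT' := hT'
  hc := hc
  hu := hu
  hc' := hc'
  hu' := hu'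
  τ := τ
  φ := φ
  n := n
  hB := hB
  f₁ := f₁
  f₂ := f₂
  h₁ := h₁
  h₂ := h₂
  hconv := hconv
  o₀ := o₀
  hiso := hiso
  hne := hne
  Lift := Lift
  hlift := hlift_of_printed E₀ (Setting.ofAdelicData pl R μ DG fdG compG hT hT') R.chi R.chi' τ tl Lift f₁ J T H
    hG hGI hMi h44 hfac hdodge harch hhol
  tf := tf
  spec := spec
  hS1 := hS1
  hS3 := hS3

end Constructors

end Summit.Ventures.HodgeRepro.Tier4.Line1

end
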